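import Summits.Ventures.Crystal3D.TopCut.X2Du61Agg3

/-!
# X2 cap cut `X2Du61` (u₀ = -61/100, degrees (d, d_X) = (10, 10)): kernel validation of Gram blocks E4 (chunk theorems okE4_7, okE4_8; cost proxy 0.06 Gbit)

HONEST FRAMING: generated data / kernel-validation file of the venture `Crystal3D` (cell `pub-crystal3d`, phase 2,
seat p2): one piece of the kernel replay of an EXACT pole-augmented («X2») Bachoc–Vallentin cap certificate on `S²`
(format `Bulk/CapX2Cert.X2Cert` of seat p1; cap level u₀ = -61/100, inner products ≤ 1/2) solved directly in
sum-of-squares form (`capx2sos.py` + `exactx2.py`: CLARABEL float solve → exact rounding → integer identities; certificate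
`x2sos_d10_dX10_u61over100`, bound value 11.983236 < 12) and checked through `TopCut/X2SOSExpand.lean` + `X2SOSCheck.lean` +
`X2SOSSound.lean` (generic checker + soundness), `TopCut/CapSOSCheck.lean` and the tree's `ThreePointCert.CheckKron`.
Nothing geometric is proved in this file; plain lists of integers / rationals / monomials and `decide +kernel` facts about
them (standard axioms only, no `native_decide`).
-/

namespace Summit.Ventures.Crystal3D.TopCut.X2Du61

open Literature.Geometry.DiscreteGeometry Literature.Geometry.DiscreteGeometry.PolyCert PolyCert.SPoly
open Literature.Geometry.DiscreteGeometry.BachocVallentin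
open Summit.Ventures.PackingBounds.ThreePointCert Summit.Ventures.Crystal3D.CapSOS Summit.Ventures.Crystal3D.CapX2 Summit.Ventures.Crystal3D.X2SOS

set_option maxRecDepth 100000 in
set_option maxHeartbeats 0 in
/-- Block `E4`: rows from 106 (12 rows) of `zᵀ(LLᵀ)z` added to `dE4c6` give `dE4c7` (kernel, Kronecker-packed chunk check). [folklore] -/
theorem okE4_7 : chunkOKK X2Du61.gE4K 106 12 X2Du61.dE4c6 X2Du61.dE4c7 = true := by
  decide +kernel

set_option maxRecDepth 100000 in
set_option maxHeartbeats 0 in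
/-- Block `E4`: rows from 118 ((X2Du61.gE4K.z.length - 118) rows) of `zᵀ(LLᵀ)z` added to `dE4c7` give `eE4` (kernel, Kronecker-packed chunk check). [folklore] -/
theorem okE4_8 : chunkOKK X2Du61.gE4K 118 (X2Du61.gE4K.z.length - 118) X2Du61.dE4c7 X2Du61.eE4 = true := by
  decide +kernel

end Summit.Ventures.Crystal3D.TopCut.X2Du61
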